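import Mathlib
import HarnessLib
import Literature.NumberTheory.DiophantineGeometry.RothPrelim

/-!
# Roth's theorem after Schmidt (LNM 785, Ch. V) — Roth's Lemma 10A, the case of one variable

Source: W. M. Schmidt, *Diophantine Approximation*, LNM 785 (1980), Ch. V §10, proof of
Theorem 10A, case `m = 1` (book p. 130) [Schmidt1980].

Schmidt's argument: if `P(X) ∈ ℤ[X]`, `P ≠ 0`, and `p₁/q₁` is in lowest terms, write
`P(X) = (X - p₁/q₁)^ℓ M(X)` with `M(p₁/q₁) ≠ 0`; by Gauss' Lemma `P = (q₁X - p₁)^ℓ R(X)` with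
`R ∈ ℤ[X]`, so `q₁^ℓ` divides the leading coefficient of `P` and `q₁^ℓ ≤ |P|`; if moreover
`|P| ≤ q₁^{E}` (`E = ω r₁ = ε r₁`, `q₁ > 1`) then `ℓ ≤ E`, while the normalised derivative
`P_ℓ(p₁/q₁) = M(p₁/q₁) ≠ 0`: the index of `P` at `p₁/q₁` w.r.t. `r₁` is `ℓ/r₁ ≤ ε`.

We prove this in the form used both for `m = 1` and inside the inductive step (for the factor
`U*(X_m)` of the Wronskian): for a polynomial in the single variable `X_{t₀}` inside
`MvPolynomial σ ℤ`, i.e. `Roth.toMv t₀ f` with `f ∈ ℤ[X]` (`Roth.rothLemma_oneVar`). The file also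
provides the (small) dictionary between `ℤ[X]` and `ℤ[X_{t₀}] ⊆ ℤ[X_σ]`: coefficients, heights,
`Roth.hasseD (ν e_{t₀}) (toMv f) = toMv (hasseDeriv ν f)`, evaluation, and the recognition of
polynomials involving only `X_{t₀}` (`Roth.exists_toMv_eq_of_degreeOf_eq_zero`).

## References

* [Schmidt1980] W. M. Schmidt, *Diophantine Approximation*, LNM 785, Springer 1980, Ch. V,
  proof of Theorem 10A (case `m = 1`), p. 130.
-/

noncomputable section

open Polynomial

namespace Literature.NumberTheory.DiophantineGeometry

namespace Roth

variable {σ : Type*} {R : Type*} [CommRing R]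

/-! ### One-variable polynomials inside `MvPolynomial σ R` -/

/-- The embedding `R[X] → R[X_σ]`, `X ↦ X_{t₀}`. [folklore] -/
def toMv (t₀ : σ) : R[X] →ₐ[R] MvPolynomial σ R :=
  Polynomial.aeval (MvPolynomial.X t₀)

/-- `toMv` on monomials: `c X^n ↦ c X_{t₀}^n`. [folklore] -/
theorem toMv_monomial (t₀ : σ) (n : ℕ) (c : R) :
    toMv t₀ (Polynomial.monomial n c) = MvPolynomial.monomial (Finsupp.single t₀ n) c := by
  rw [toMv, Polynomial.aeval_monomial, MvPolynomial.algebraMap_eq,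
    MvPolynomial.C_mul_X_pow_eq_monomial]

/-- Coefficients of `toMv t₀ f`: the coefficient of `X_{t₀}^n` is `f_n`, all others vanish.
[folklore] -/
theorem coeff_toMv [DecidableEq σ] (t₀ : σ) (f : R[X]) (j : σ →₀ ℕ) :
    MvPolynomial.coeff j (toMv t₀ f) =
      if j = Finsupp.single t₀ (j t₀) then f.coeff (j t₀) else 0 := by
  induction f using Polynomial.induction_on' with
  | add p q hp hq =>
    rw [map_add, MvPolynomial.coeff_add, hp, hq, Polynomial.coeff_add]
    split_ifs <;> ring
  | monomial n c =>
    rw [toMv_monomial, MvPolynomial.coeff_monomial, Polynomial.coeff_monomial]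
    by_cases h : Finsupp.single t₀ n = j
    · subst h
      simp
    · rw [if_neg h]
      split_ifs with h1 h2
      · exfalso; apply h; rw [h1, h2]
      · rfl
      · rfl

/-- The coefficient of `X_{t₀}^n` in `toMv t₀ f` is `f_n`. [folklore] -/
theorem coeff_toMv_single [DecidableEq σ] (t₀ : σ) (f : R[X]) (n : ℕ) :
    MvPolynomial.coeff (Finsupp.single t₀ n) (toMv t₀ f) = f.coeff n := by
  rw [coeff_toMv]; simp

/-- `toMv t₀` is injective. [folklore] -/
theorem toMv_injective [DecidableEq σ] (t₀ : σ) : Function.Injective (toMv (R := R) t₀) := by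
  intro f g h
  ext n
  rw [← coeff_toMv_single t₀ f n, ← coeff_toMv_single t₀ g n, h]

/-- `toMv t₀ f ≠ 0` for `f ≠ 0`. [folklore] -/
theorem toMv_ne_zero [DecidableEq σ] (t₀ : σ) {f : R[X]} (hf : f ≠ 0) : toMv t₀ f ≠ 0 :=
  fun h => hf (toMv_injective t₀ (by rw [h, map_zero]))

/-- `toMv t₀ f` does not involve the other variables. [folklore] -/
theorem degreeOf_toMv_of_ne [DecidableEq σ] (t₀ : σ) (f : R[X]) {h : σ} (hh : h ≠ t₀) :
    (toMv t₀ f).degreeOf h = 0 := by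
  rw [← Nat.le_zero, MvPolynomial.degreeOf_le_iff]
  intro j hj
  rw [MvPolynomial.mem_support_iff, coeff_toMv] at hj
  split_ifs at hj with h1
  · rw [h1, Finsupp.single_apply, if_neg hh.symm]
  · exact absurd rfl hj

/-- **Normalised derivatives of one-variable polynomials**: `(toMv f)_{ν e_{t₀}} = toMv (D^{(ν)} f)`
with Mathlib's Hasse derivative `D^{(ν)} = hasseDeriv ν`. [cite: Schmidt1980, Ch. V §5 (5.1)] -/
theorem hasseD_single_toMv [DecidableEq σ] (t₀ : σ) (ν : ℕ) (f : R[X]) :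
    hasseD (Finsupp.single t₀ ν) (toMv t₀ f) = toMv t₀ (hasseDeriv ν f) := by
  ext j
  rw [coeff_hasseD, coeff_toMv, coeff_toMv, hasseDeriv_coeff,
    Finsupp.prod_single_index (by simp)]
  simp only [Finsupp.coe_add, Pi.add_apply, Finsupp.single_eq_same]
  have key : (j + Finsupp.single t₀ ν = Finsupp.single t₀ (j t₀ + ν)) ↔
      (j = Finsupp.single t₀ (j t₀)) := by
    constructor
    · intro h
      ext h'
      have h1 := DFunLike.congr_fun h h'
      simp only [Finsupp.coe_add, Pi.add_apply, Finsupp.single_apply] at h1 ⊢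
      by_cases h2 : t₀ = h'
      · subst h2; simp
      · simp only [if_neg h2, add_zero] at h1 ⊢; exact h1
    · intro hj
      conv_lhs => rw [hj]
      rw [← Finsupp.single_add]
  by_cases hj : j = Finsupp.single t₀ (j t₀)
  · rw [if_pos (key.mpr hj), if_pos hj]
  · rw [if_neg (mt key.mp hj), if_neg hj, mul_zero]

/-- Normalised derivatives of `toMv t₀ f` in directions involving another variable vanish.
[folklore] -/
theorem hasseD_toMv_eq_zero [Fintype σ] [DecidableEq σ] (t₀ : σ) (f : R[X]) {i : σ →₀ ℕ} {h : σ}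
    (hh : h ≠ t₀) (hi : i h ≠ 0) : hasseD i (toMv t₀ f) = 0 :=
  hasseD_eq_zero_of_degreeOf_lt (h := h) (by rw [degreeOf_toMv_of_ne t₀ f hh]; omega)

/-- A multi-index on `σ` either is a multiple of `e_{t₀}` or has a non-zero component elsewhere.
[folklore] -/
theorem eq_single_or_exists_ne [DecidableEq σ] (t₀ : σ) (i : σ →₀ ℕ) :
    i = Finsupp.single t₀ (i t₀) ∨ ∃ h, h ≠ t₀ ∧ i h ≠ 0 := by
  by_cases h : ∃ h, h ≠ t₀ ∧ i h ≠ 0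
  · exact Or.inr h
  · left
    push Not at h
    ext h'
    rw [Finsupp.single_apply]
    split_ifs with h1
    · rw [h1]
    · exact h h' (Ne.symm h1)

/-- Evaluation: `(toMv t₀ f)(a) = f(a_{t₀})`. [folklore] -/
theorem aeval_toMv {A : Type*} [CommRing A] [Algebra R A] (t₀ : σ) (f : R[X]) (a : σ → A) :
    MvPolynomial.aeval a (toMv t₀ f) = Polynomial.aeval (a t₀) f := by
  rw [toMv, ← Polynomial.aeval_algHom_apply, MvPolynomial.aeval_X]

/-- A polynomial involving only the variable `X_{t₀}` is of the form `toMv t₀ f`.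
[folklore] -/
theorem exists_toMv_eq_of_degreeOf_eq_zero [DecidableEq σ] (t₀ : σ) (U : MvPolynomial σ R)
    (hU : ∀ h, h ≠ t₀ → U.degreeOf h = 0) : ∃ f : R[X], toMv t₀ f = U := by
  classical
  refine ⟨∑ j ∈ U.support, Polynomial.monomial (j t₀) (MvPolynomial.coeff j U), ?_⟩
  rw [map_sum]
  conv_rhs => rw [U.as_sum]
  apply Finset.sum_congr rfl
  intro j hj
  have hj' : Finsupp.single t₀ (j t₀) = j := by
    ext h
    rw [Finsupp.single_apply]
    split_ifs with h1
    · rw [h1]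
    · have := MvPolynomial.monomial_le_degreeOf h hj
      rw [hU h (Ne.symm h1)] at this
      omega
  rw [toMv_monomial, hj']

/-! ### The case `m = 1` of Roth's Lemma -/

/-- `(D^{(ν)} f).map = D^{(ν)} (f.map)`. [folklore] -/
theorem hasseDeriv_map' {S : Type*} [CommRing S] (φ : R →+* S) (ν : ℕ) (f : R[X]) :
    (hasseDeriv ν f).map φ = hasseDeriv ν (f.map φ) := by
  ext n
  simp [hasseDeriv_coeff, Polynomial.coeff_map]

/-- **Taylor at a root**: the `ℓ`-th normalised derivative of `f` does not vanish at a root of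
exact multiplicity `ℓ`. [cite: Schmidt1980, Ch. V §10 (proof of Thm 10A, m = 1)] -/
theorem eval_hasseDeriv_rootMultiplicity_ne_zero (g : R[X]) (hg : g ≠ 0) (a : R) :
    (hasseDeriv (g.rootMultiplicity a) g).eval a ≠ 0 := by
  set ℓ := g.rootMultiplicity a with hℓ
  set M := g /ₘ (Polynomial.X - Polynomial.C a) ^ ℓ with hM
  have hgM : (Polynomial.X - Polynomial.C a) ^ ℓ * M = g :=
    pow_mul_divByMonic_rootMultiplicity_eq g a
  have hMa : M.eval a ≠ 0 := eval_divByMonic_pow_rootMultiplicity_ne_zero a hg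
  rw [← taylor_coeff, ← hgM, taylor_mul, taylor_pow, map_sub, taylor_X, taylor_C,
    add_sub_cancel_right, Polynomial.coeff_X_pow_mul', if_pos le_rfl, Nat.sub_self,
    taylor_coeff_zero]
  exact hMa

/-- `q X - p` is primitive when `gcd(p, q) = 1`. [folklore] -/
theorem isPrimitive_C_mul_X_sub_C {p : ℤ} {q : ℕ} (hcop : Nat.Coprime p.natAbs q) :
    (Polynomial.C (q : ℤ) * Polynomial.X - Polynomial.C p).IsPrimitive := by
  rw [Polynomial.isPrimitive_iff_isUnit_of_C_dvd]
  intro r hr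
  rw [Polynomial.C_dvd_iff_dvd_coeff] at hr
  have h1 : r ∣ (q : ℤ) := by
    have := hr 1
    simp only [Polynomial.coeff_sub, Polynomial.coeff_C_mul, Polynomial.coeff_X_one, mul_one,
      Polynomial.coeff_C_of_ne_zero one_ne_zero, sub_zero] at this
    exact this
  have h0 : r ∣ p := by
    have := hr 0
    simp only [Polynomial.coeff_sub, Polynomial.coeff_C_mul, Polynomial.coeff_X_zero, mul_zero,
      Polynomial.coeff_C_zero, zero_sub, dvd_neg] at this
    exact this
  have : r.natAbs ∣ Nat.gcd p.natAbs q :=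
    Nat.dvd_gcd (Int.natAbs_dvd_natAbs.mpr h0) (by
      have := Int.natAbs_dvd_natAbs.mpr h1
      rwa [Int.natAbs_natCast] at this)
  rw [hcop] at this
  exact Int.isUnit_iff_natAbs_eq.mpr (Nat.dvd_one.mp this)

/-- **Gauss' Lemma step of Roth's Lemma (`m = 1`)**: if `p/q` (lowest terms, `q > 0`) is a root
of multiplicity `ℓ` of `0 ≠ f ∈ ℤ[X]` over `ℚ`, then `q^ℓ` divides the leading coefficient of
`f` (`f = (qX - p)^ℓ R` with `R ∈ ℤ[X]`). [cite: Schmidt1980, Ch. V §10 (10.7)] -/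
theorem pow_rootMultiplicity_dvd_leadingCoeff (f : ℤ[X]) (p : ℤ) (q : ℕ) (hq : 0 < q)
    (hcop : Nat.Coprime p.natAbs q) :
    ((q : ℤ) ^ (f.map (Int.castRingHom ℚ)).rootMultiplicity ((p : ℚ) / q)) ∣ f.leadingCoeff := by
  set ℓ := (f.map (Int.castRingHom ℚ)).rootMultiplicity ((p : ℚ) / q) with hℓ
  set D : ℤ[X] := (Polynomial.C (q : ℤ) * Polynomial.X - Polynomial.C p) ^ ℓ with hD
  have hlin : (Polynomial.C (q : ℤ) * Polynomial.X - Polynomial.C p).IsPrimitive :=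
    isPrimitive_C_mul_X_sub_C hcop
  have hDprim : D.IsPrimitive := by
    rw [hD]
    induction ℓ with
    | zero => simp [Polynomial.isPrimitive_one]
    | succ n ih => rw [pow_succ]; exact ih.mul hlin
  -- over `ℚ`, `D = q^ℓ (X - p/q)^ℓ` divides `f`
  have hq0 : (q : ℚ) ≠ 0 := by exact_mod_cast hq.ne'
  have hDmap : D.map (Int.castRingHom ℚ) =
      Polynomial.C ((q : ℚ) ^ ℓ) * (Polynomial.X - Polynomial.C ((p : ℚ) / q)) ^ ℓ := by
    rw [hD, Polynomial.map_pow, Polynomial.map_sub, Polynomial.map_mul, Polynomial.map_C,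
      Polynomial.map_X, Polynomial.map_C, Polynomial.C_pow, ← mul_pow]
    congr 1
    rw [mul_sub, ← Polynomial.C_mul, mul_div_cancel₀ _ hq0]
    simp
  have hdvdQ : D.map (Int.castRingHom ℚ) ∣ f.map (Int.castRingHom ℚ) := by
    rw [hDmap]
    have hu : IsUnit (Polynomial.C ((q : ℚ) ^ ℓ)) :=
      Polynomial.isUnit_C.mpr (IsUnit.pow _ (Ne.isUnit hq0))
    exact (hu.mul_left_dvd).mpr (pow_rootMultiplicity_dvd _ _)
  have hdvd : D ∣ f := (IsPrimitive.Int.dvd_iff_map_cast_dvd_map_cast D f hDprim).mpr hdvdQ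
  obtain ⟨E, hE⟩ := hdvd
  have hlcD : D.leadingCoeff = (q : ℤ) ^ ℓ := by
    rw [hD, leadingCoeff_pow]
    congr 1
    have hq0' : (q : ℤ) ≠ 0 := by exact_mod_cast hq.ne'
    rw [sub_eq_add_neg, leadingCoeff_add_of_degree_lt', leadingCoeff_C_mul_X]
    rw [degree_neg, degree_C_mul_X hq0']
    exact degree_C_le.trans_lt (by norm_num)
  rw [hE, leadingCoeff_mul, hlcD]
  exact Dvd.intro _ rfl

/-- **Roth's Lemma for a polynomial in one variable** (Schmidt, Theorem 10A, case `m = 1`, in the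
form used also for the factor `U*(X_m)` of the inductive step): let `f ∈ ℤ[X]`, `f ≠ 0`, viewed as
the polynomial `toMv t₀ f` in the variable `X_{t₀}` of `ℤ[X_σ]`; let `a` be a point with
`a_{t₀} = p/q` in lowest terms, `q > 1`, and suppose `|toMv t₀ f| ≤ q^E`. Then some normalised
derivative `(toMv f)_{ν e_{t₀}}` with `ν ≤ E` does not vanish at `a` (indeed `ν = ` the
multiplicity of `p/q` as a root of `f`, and `q^ν ≤ |f| ≤ q^E` by Gauss' Lemma).
[cite: Schmidt1980, Ch. V Thm 10A (case m = 1, p. 130)] -/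
theorem rothLemma_oneVar [Fintype σ] [DecidableEq σ] (t₀ : σ) (f : ℤ[X]) (hf : f ≠ 0)
    (a : σ → ℝ) (p : ℤ) (q : ℕ) (hq : 1 < q) (hcop : Nat.Coprime p.natAbs q)
    (ha : a t₀ = (p : ℝ) / q) (E : ℝ) (hE : (height (toMv t₀ f) : ℝ) ≤ (q : ℝ) ^ E) :
    ∃ ν : ℕ, (ν : ℝ) ≤ E ∧
      MvPolynomial.aeval a (hasseD (Finsupp.single t₀ ν) (toMv t₀ f)) ≠ 0 := by
  set fQ := f.map (Int.castRingHom ℚ) with hfQ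
  set ℓ := fQ.rootMultiplicity ((p : ℚ) / q) with hℓ
  have hq0 : 0 < q := lt_trans zero_lt_one hq
  have hfQ0 : fQ ≠ 0 := by
    rw [hfQ]; exact (Polynomial.map_ne_zero_iff (Int.castRingHom ℚ).injective_int).mpr hf
  refine ⟨ℓ, ?_, ?_⟩
  · -- `q^ℓ ≤ |lc f| ≤ |toMv f| ≤ q^E`
    have hdvd := pow_rootMultiplicity_dvd_leadingCoeff f p q hq0 hcop
    have hlc0 : f.leadingCoeff ≠ 0 := leadingCoeff_ne_zero.mpr hf
    have h1 : q ^ ℓ ≤ f.leadingCoeff.natAbs := by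
      have := Int.natAbs_dvd_natAbs.mpr hdvd
      rw [Int.natAbs_pow, Int.natAbs_natCast] at this
      exact Nat.le_of_dvd (Int.natAbs_pos.mpr hlc0) this
    have h2 : f.leadingCoeff.natAbs ≤ height (toMv t₀ f) := by
      rw [Polynomial.leadingCoeff, ← coeff_toMv_single t₀ f]
      exact natAbs_coeff_le_height _ _
    have h3 : ((q : ℝ)) ^ (ℓ : ℝ) ≤ (q : ℝ) ^ E := by
      rw [Real.rpow_natCast]
      calc ((q : ℝ)) ^ ℓ = ((q ^ ℓ : ℕ) : ℝ) := by push_cast; ring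
        _ ≤ (height (toMv t₀ f) : ℝ) := by exact_mod_cast h1.trans h2
        _ ≤ (q : ℝ) ^ E := hE
    exact (Real.rpow_le_rpow_left_iff (by exact_mod_cast hq)).mp h3
  · -- `(toMv f)_{ℓ e_{t₀}}(a) = (D^{(ℓ)} f)(p/q) ≠ 0`
    rw [hasseD_single_toMv, aeval_toMv, ha]
    have hne := eval_hasseDeriv_rootMultiplicity_ne_zero fQ hfQ0 ((p : ℚ) / q)
    rw [← hℓ, hfQ, ← hasseDeriv_map', Polynomial.eval_map, ← algebraMap_int_eq,
      ← Polynomial.aeval_def] at hne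
    have hcast : Polynomial.aeval ((p : ℝ) / q) (hasseDeriv ℓ f) =
        ((Polynomial.aeval ((p : ℚ) / q) (hasseDeriv ℓ f) : ℚ) : ℝ) := by
      have := Polynomial.aeval_algHom_apply ((Rat.castHom ℝ).toIntAlgHom) ((p : ℚ) / q)
        (hasseDeriv ℓ f)
      simp only [RingHom.toIntAlgHom_apply, Rat.coe_castHom, Rat.cast_div, Rat.cast_intCast,
        Rat.cast_natCast] at this
      exact this
    rw [hcast]
    exact_mod_cast hne

end Roth

end Literature.NumberTheory.DiophantineGeometry
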